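import Literature.Probability.Percolation.ArmSeparationRingIndex
import Literature.Probability.Percolation.TriAnnulusCircuit
import Mathlib.Tactic.Ring
import HarnessLib

/-!
# Separation of tubes of one thin ring, by side and lateral index

Topic: Probability / Percolation; family `crit-perc`. A brick of the GENERIC landing layer of
Nolin's arm-separation theorem (Nolin 2008, Thm. 11, §4.4 [arXiv 0711.4948: Thm. 10, p. 12,
Fig. 6: "RSW in corridors"]), towards
`Literature.Probability.Percolation.Nolin2008_prop17_quasiMult` (`FiveArmExponentFacts.lean`).

The staircase corridors of different exits use, on every ring level, tubes of the SAME thin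
ring `thinRing r e s`, at lateral positions kept apart by the schedule. This file turns lateral
separation into disjointness of the tube boxes: two tubes of the ring (`ringTube r e s g`, any
positions, pieces or connector squares) have disjoint boxes as soon as their sides and lateral
indices (`ringSide`, `ringLat`) are SEPARATED (`Staircase.LatSep`): on the same side, lateral
indices two apart; on adjacent sides, together at least four cells away from the common corner;
on non-adjacent sides, always (`4e ≤ s`, `8e + 2s ≤ r`). The proof is coordinates: the bounds
`ringTube_bounds` (sector, lateral range, norm band), the depth range `ringTube_dep` and
`triNorm_eq_max`, case by case over the
`36` pairs of sides (`omega`).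

## Main results

* `Staircase.ringTube_disjoint_ringTube` — separated tubes of one thin ring are disjoint.

## References

* P. Nolin, *Near-critical percolation in two dimensions*, Electron. J. Probab. 13 (2008), §4.3
  Prop. 12 (proof), §4.4 (arXiv 0711.4948: Prop. 11; proof of Thm. 10, p. 12, Fig. 6). [Nolin2008]
-/

noncomputable section

namespace Literature.Probability.Percolation

open LatticeModels Tube

namespace Staircase

/-! ### Depth of the ring tubes -/

/-- The depth coordinate of the reflection: `dep i (-v) = dep (i + 3) v` (`i < 3`). [folklore] -/
theorem dep_neg {i : ℕ} (hi : i < 3) (v : Site 2) : dep i (-v) = dep (i + 3) v := by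
  interval_cases i
  · simp only [dep, Pi.neg_apply]
  · simp only [dep, Pi.neg_apply]; ring
  · simp only [dep, Pi.neg_apply]

/-- Side `0` block: depth `x₀ ∈ [r - e, r + e]`. [folklore] -/
theorem vblock_dep {r e s j : ℕ} {T : Tube} (hT : T = vPiece r (-(r : ℤ)) e s j ∨ T = vConn r (-(r : ℤ)) e s j) {v : Site 2}
    (hv : v ∈ T.box) : (r : ℤ) - s - 2 * e ≤ dep 0 v ∧ dep 0 v ≤ (r : ℤ) + 2 * e := by
  have hs0 : (0 : ℤ) ≤ s := by positivity
  have he0 : (0 : ℤ) ≤ e := by positivity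
  simp only [dep]
  rcases hT with rfl | rfl
  · rw [Tube.mem_box] at hv; simp only [vPiece, Nat.cast_add, Nat.cast_mul, Nat.cast_ofNat] at hv
    exact ⟨by linarith, by linarith⟩
  · rw [Tube.mem_box] at hv; simp only [vConn, Nat.cast_mul, Nat.cast_ofNat] at hv
    exact ⟨by linarith, by linarith⟩

/-- Side `1` block: depth `x₀ + x₁ ∈ [r - s - 2e, r + 2e]`. [folklore] -/
theorem sblock_dep {r e s j : ℕ} {T : Tube} (hT : T = stairH r e s j ∨ T = stairV r e s j) {v : Site 2} (hv : v ∈ T.box) :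
    (r : ℤ) - s - 2 * e ≤ dep 1 v ∧ dep 1 v ≤ (r : ℤ) + 2 * e := by
  have hs0 : (0 : ℤ) ≤ s := by positivity
  have he0 : (0 : ℤ) ≤ e := by positivity
  simp only [dep]
  rcases hT with rfl | rfl
  · rw [Tube.mem_box] at hv; simp only [stairH, Nat.cast_add, Nat.cast_mul, Nat.cast_ofNat] at hv
    exact ⟨by linarith, by linarith⟩
  · rw [Tube.mem_box] at hv; simp only [stairV, Nat.cast_add, Nat.cast_mul, Nat.cast_ofNat] at hv
    exact ⟨by linarith, by linarith⟩

/-- Side `2` block: depth `x₁ ∈ [r - e, r + e]`. [folklore] -/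
theorem hblock_dep {r e s j : ℕ} {T : Tube} (hT : T = hPiece 0 r e s j ∨ T = hConn 0 r e s j) {v : Site 2} (hv : v ∈ T.box) :
    (r : ℤ) - s - 2 * e ≤ dep 2 v ∧ dep 2 v ≤ (r : ℤ) + 2 * e := by
  have hs0 : (0 : ℤ) ≤ s := by positivity
  have he0 : (0 : ℤ) ≤ e := by positivity
  simp only [dep]
  rcases hT with rfl | rfl
  · rw [Tube.mem_box] at hv; simp only [hPiece, Nat.cast_add, Nat.cast_mul, Nat.cast_ofNat] at hv
    exact ⟨by linarith, by linarith⟩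
  · rw [Tube.mem_box] at hv; simp only [hConn, Nat.cast_mul, Nat.cast_ofNat] at hv
    exact ⟨by linarith, by linarith⟩

/-- Depth of the tubes of the half ring (`ℓ < 6n - 2`). [folklore] -/
theorem halfTube_dep {r e s : ℕ} {ℓ : ℕ} (hℓ : ℓ < 6 * (r / s) - 2) {v : Site 2} (hv : v ∈ (halfTube r e s ℓ).box) :
    (r : ℤ) - s - 2 * e ≤ dep (ringSide r s ℓ) v ∧ dep (ringSide r s ℓ) v ≤ (r : ℤ) + 2 * e := by
  have hside : ringSide r s ℓ = (if ℓ < 2 * (r / s) - 1 then 0 else if ℓ < 4 * (r / s) - 1 then 1 else 2) := by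
    unfold ringSide; rw [if_pos hℓ]
  unfold halfTube at hv
  by_cases h1 : ℓ < 2 * (r / s) - 1
  · rw [if_pos h1] at hv hside
    rw [hside]
    refine vblock_dep (j := ℓ / 2) ?_ hv
    split_ifs
    · exact Or.inl rfl
    · exact Or.inr rfl
  · rw [if_neg h1] at hv hside
    by_cases h3 : ℓ < 4 * (r / s) - 1
    · rw [if_pos h3] at hv hside
      rw [hside]
      refine sblock_dep (j := (ℓ - (2 * (r / s) - 1)) / 2) ?_ hv
      split_ifs
      · exact Or.inl rfl
      · exact Or.inr rfl
    · rw [if_neg h3] at hv hside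
      rw [hside]
      refine hblock_dep (j := (ℓ - (4 * (r / s) - 1)) / 2) ?_ hv
      split_ifs
      · exact Or.inl rfl
      · exact Or.inr rfl

/-- **Depth of the tubes of the thin ring**: the depth coordinate of the `g`-th tube in the frame
of its side lies in `[r - s - 2e, r + 2e]` (`g < 12n - 4`). [folklore] -/
theorem ringTube_dep {r e s : ℕ} {g : ℕ} (hg : g < 12 * (r / s) - 4) {v : Site 2} (hv : v ∈ (ringTube r e s g).box) :
    (r : ℤ) - s - 2 * e ≤ dep (ringSide r s g) v ∧ dep (ringSide r s g) v ≤ (r : ℤ) + 2 * e := by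
  unfold ringTube at hv
  by_cases h : g < 6 * (r / s) - 2
  · rw [if_pos h] at hv
    exact halfTube_dep h hv
  · rw [if_neg h] at hv
    have hv' := mem_box_neg.1 hv
    have hℓ : g - (6 * (r / s) - 2) < 6 * (r / s) - 2 := by omega
    have hb := halfTube_dep hℓ hv'
    have hs3 : ringSide r s (g - (6 * (r / s) - 2)) < 3 := by
      unfold ringSide; rw [if_pos hℓ]; split_ifs <;> omega
    have hside : ringSide r s g = ringSide r s (g - (6 * (r / s) - 2)) + 3 := by
      unfold ringSide; rw [if_neg h, if_pos hℓ]; split_ifs <;> rfl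
    rw [hside, ← dep_neg hs3]
    exact hb

/-! ### Separation -/

/-- Cells from the cell of lateral index `l` on the side `i` to the END of the side
(counterclockwise); on the sides `2, 5` the lateral index runs clockwise. [folklore] -/
def toEnd (n i l : ℕ) : ℕ := if i % 3 = 2 then l else n - 1 - l

/-- Cells from the START of the side `i` (counterclockwise) to the cell of lateral index `l`. [folklore] -/
def fromStart (n i l : ℕ) : ℕ := if i % 3 = 2 then n - 1 - l else l

/-- **Lateral separation of two cells `(i, l)`, `(i', l')` of a ring with `n` chunks per side**
(lateral indices as in `ringLat`): same side and indices two apart, or adjacent sides and at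
least four cells between them through the common corner, or non-adjacent sides. [folklore] -/
def LatSep (n i l i' l' : ℕ) : Prop :=
  (i = i' ∧ (l + 2 ≤ l' ∨ l' + 2 ≤ l)) ∨
  (i ≠ i' ∧ i' = (i + 1) % 6 ∧ 4 ≤ toEnd n i l + fromStart n i' l') ∨
  (i ≠ i' ∧ i = (i' + 1) % 6 ∧ 4 ≤ toEnd n i' l' + fromStart n i l) ∨
  (i ≠ i' ∧ i' ≠ (i + 1) % 6 ∧ i ≠ (i' + 1) % 6)

/-- `LatSep` is symmetric. [folklore] -/
theorem LatSep.symm {n i l i' l' : ℕ} (h : LatSep n i l i' l') : LatSep n i' l' i l := by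
  unfold LatSep at h ⊢
  rcases h with ⟨h1, h2⟩ | ⟨h1, h2, h3⟩ | ⟨h1, h2, h3⟩ | ⟨h1, h2, h3⟩
  · exact Or.inl ⟨h1.symm, h2.symm⟩
  · exact Or.inr (Or.inr (Or.inl ⟨Ne.symm h1, h2, h3⟩))
  · exact Or.inr (Or.inl ⟨Ne.symm h1, h2, h3⟩)
  · exact Or.inr (Or.inr (Or.inr ⟨Ne.symm h1, h3, h2⟩))

set_option maxHeartbeats 4000000 in
/-- **Separated tubes of one thin ring are disjoint** (`1 ≤ n = r / s`, `s ∣ r`, `4e ≤ s`,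
`2s + 8e ≤ r`, positions `g, g' < 12n - 4` with separated (side, lateral index)). [cite: Nolin2008, §4.3 Prop. 12 (proof) (arXiv 0711.4948: Prop. 11), corridors kept apart] -/
theorem ringTube_disjoint_ringTube {r e s : ℕ} (hr : 1 ≤ r / s) (hsr : s ∣ r) (hes : 4 * e ≤ s) (hsr2 : 2 * s + 8 * e ≤ r)
    {g g' : ℕ} (hg : g < 12 * (r / s) - 4) (hg' : g' < 12 * (r / s) - 4)
    (hsep : LatSep (r / s) (ringSide r s g) (ringLat r s g) (ringSide r s g') (ringLat r s g')) :
    Disjoint (ringTube r e s g).box (ringTube r e s g').box := by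
  have he : 2 * e ≤ r := by omega
  have hs1 : 1 ≤ s := Nat.pos_of_ne_zero fun h => by simp [h] at hr
  have hns : (r / s) * s = r := Nat.div_mul_cancel hsr
  rw [Set.disjoint_left]
  intro v hv hv'
  obtain ⟨hsec, hl1, hl2, hn1, hn2⟩ := ringTube_bounds hr hsr he hg hv
  obtain ⟨hsec', hl1', hl2', -, -⟩ := ringTube_bounds hr hsr he hg' hv'
  obtain ⟨hd1, hd2⟩ := ringTube_dep hg hv
  obtain ⟨hd1', hd2'⟩ := ringTube_dep hg' hv'
  have hlt := ringLat_lt (r := r) (s := s) (g := g) hr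
  have hlt' := ringLat_lt (r := r) (s := s) (g := g') hr
  have hnorm := triNorm_eq_max v
  -- name the sides and lateral indices
  have hi6 := ringSide_lt r s g
  have hi6' := ringSide_lt r s g'
  generalize hI : ringSide r s g = i at hsec hl1 hl2 hsep hi6 hd1 hd2
  generalize hI' : ringSide r s g' = i' at hsec' hl1' hl2' hsep hi6' hd1' hd2'
  generalize hL : ringLat r s g = l at hl1 hl2 hsep hlt
  generalize hL' : ringLat r s g' = l' at hl1' hl2' hsep hlt'
  generalize hN : r / s = n at hsep hlt hlt' hns
  -- linear bookkeeping of the products `l s`, `l' s`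
  have hns' : ((n : ℕ) : ℤ) * s = r := by exact_mod_cast hns
  have hes' : 4 * (e : ℤ) ≤ s := by exact_mod_cast hes
  have hsr2' : 2 * (s : ℤ) + 8 * e ≤ r := by exact_mod_cast hsr2
  have hs1' : (1 : ℤ) ≤ s := by exact_mod_cast hs1
  have hs0 : (0 : ℤ) ≤ s := by positivity
  have hLs0 : 0 ≤ (l : ℤ) * s := by positivity
  have hLs0' : 0 ≤ (l' : ℤ) * s := by positivity
  have hLs : (l : ℤ) * s + s ≤ r := by
    have h := mul_le_mul_of_nonneg_right (show (l : ℤ) + 1 ≤ n by exact_mod_cast hlt) hs0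
    linarith
  have hLs' : (l' : ℤ) * s + s ≤ r := by
    have h := mul_le_mul_of_nonneg_right (show (l' : ℤ) + 1 ≤ n by exact_mod_cast hlt') hs0
    linarith
  rw [add_mul, one_mul] at hl2 hl2'
  -- the separation, linearised
  have hsep' : (i = i' ∧ ((l : ℤ) * s + 2 * s ≤ l' * s ∨ (l' : ℤ) * s + 2 * s ≤ l * s)) ∨
      (i' = (i + 1) % 6 ∧ 4 * (s : ℤ) ≤ (if i % 3 = 2 then (l : ℤ) * s else r - s - l * s) +
        (if i' % 3 = 2 then (r : ℤ) - s - l' * s else l' * s)) ∨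
      (i = (i' + 1) % 6 ∧ 4 * (s : ℤ) ≤ (if i' % 3 = 2 then (l' : ℤ) * s else r - s - l' * s) +
        (if i % 3 = 2 then (r : ℤ) - s - l * s else l * s)) ∨
      (i ≠ i' ∧ i' ≠ (i + 1) % 6 ∧ i ≠ (i' + 1) % 6) := by
    have hcast : ∀ m, m < n → (((n - 1 - m : ℕ) : ℤ)) * s = r - s - m * s := fun m hm => by
      rw [Nat.cast_sub (by omega), Nat.cast_sub (by omega)]; push_cast; nlinarith [hns']
    have hte : ∀ j m, m < n → ((toEnd n j m : ℕ) : ℤ) * s = (if j % 3 = 2 then (m : ℤ) * s else r - s - m * s) := by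
      intro j m hm; unfold toEnd; split_ifs
      · rfl
      · exact hcast m hm
    have hfs : ∀ j m, m < n → ((fromStart n j m : ℕ) : ℤ) * s = (if j % 3 = 2 then (r : ℤ) - s - m * s else m * s) := by
      intro j m hm; unfold fromStart; split_ifs
      · exact hcast m hm
      · rfl
    unfold LatSep at hsep
    rcases hsep with ⟨h1, h2⟩ | ⟨-, h2, h3⟩ | ⟨-, h2, h3⟩ | h
    · refine Or.inl ⟨h1, ?_⟩
      rcases h2 with h2 | h2
      · left
        have h := mul_le_mul_of_nonneg_right (show (l : ℤ) + 2 ≤ l' by exact_mod_cast h2) hs0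
        linarith
      · right
        have h := mul_le_mul_of_nonneg_right (show (l' : ℤ) + 2 ≤ l by exact_mod_cast h2) hs0
        linarith
    · refine Or.inr (Or.inl ⟨h2, ?_⟩)
      have h3z : (4 : ℤ) ≤ (toEnd n i l : ℕ) + (fromStart n i' l' : ℕ) := by exact_mod_cast h3
      have h := mul_le_mul_of_nonneg_right h3z hs0
      rw [add_mul, hte i l hlt, hfs i' l' hlt'] at h
      linarith
    · refine Or.inr (Or.inr (Or.inl ⟨h2, ?_⟩))
      have h3z : (4 : ℤ) ≤ (toEnd n i' l' : ℕ) + (fromStart n i l : ℕ) := by exact_mod_cast h3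
      have h := mul_le_mul_of_nonneg_right h3z hs0
      rw [add_mul, hte i' l' hlt', hfs i l hlt] at h
      linarith
    · exact Or.inr (Or.inr (Or.inr h))
  -- the norm band, linearised
  have hbig : (r : ℤ) - s - 2 * e ≤ v 0 ∨ (r : ℤ) - s - 2 * e ≤ -v 0 ∨ (r : ℤ) - s - 2 * e ≤ v 1 ∨
      (r : ℤ) - s - 2 * e ≤ -v 1 ∨ (r : ℤ) - s - 2 * e ≤ v 0 + v 1 ∨ (r : ℤ) - s - 2 * e ≤ -(v 0 + v 1) := by
    rw [hnorm] at hn1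
    simpa only [le_max_iff, or_assoc] using hn1
  clear hsep hlt hlt' hns hv hv' hg hg' hn1 hn2 hnorm
  generalize (l : ℤ) * s = Ls at hLs0 hLs hl1 hl2 hsep'
  generalize (l' : ℤ) * s = Ls' at hLs0' hLs' hl1' hl2' hsep'
  interval_cases i <;> interval_cases i' <;>
    simp only [sectorNear, lat, dep, Set.mem_setOf_eq] at hsec hsec' hl1 hl2 hl1' hl2' hd1 hd2 hd1' hd2' <;>
    simp only [Nat.reduceMod, Nat.reduceAdd, Nat.reduceEqDiff, reduceIte, true_and, false_and, or_false, false_or,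
      ne_eq, not_true_eq_false, not_false_eq_true, and_true, and_self] at hsep' <;> omega

end Staircase

end Literature.Probability.Percolation
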